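/-
Copyright (c) 2026 the pub-hodgecm-mathlib formalisation cell (harness21).  Prover seat hodgecm-mathlib-LH7-p01 (g3): line LH7 (closer row `stub_PKtupleK2`, #181 III-127;
h413 = stmt-HodgeConjecture-24833), leaf ED. 3 road, O8b census residual (ii) «places → finite adèles» in the CM currency; 2026-09-02.
-/
import Summits.HodgeConjecture.HodgeConjecture.Theorems.F0P3cPKtupleU2LocalIsotypyCompact   -- ★ p850240 (compact-subgroup bite; brings ★ (γ′) `F0P3cPKtupleU1Line`: `cmDetChar`, `isAutomorphic_eta_mul_psi`, ★ (β) `Realises₂`)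
import Summits.HodgeConjecture.HodgeConjecture.Theorems.F0P3cPKtupleU2LineUnique           -- ★ p850173: `realises₂_unique_of_isotypy_at`, `pkMultOneU2Shape_of_isotypy` (O8b ⟺ isotypy)
import Literature.NumberTheory.Automorphic.DiscreteAutomorphicRepFinAdelicScalar              -- ★ p850461 (this seat): `DiscreteAutomorphicRep.toContRep_finAdelicToAdelic_apply_eq_smul_of_forall_inclPlaceAdelic`, `…_of_forall_archToAdelic`, `dense_finRep_smoothPart`
import HarnessLib

/-!
# LH7 leaf ED. 3, (O8b♭) — from the finite places to `U(Φ₂)(𝔸_{L⁺,f})` on ALL of `P₂`, and the reduction of the ISOTYPY letter to its archimedean component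
# ([Rogawski1990] §13.3 p. 203 «`m(ξ) = 1`»; [BorelJacquet1979] §4.6)

Cell `pub/hodgecm-mathlib` (D-0151), crux H413 = `stmt-HodgeConjecture-24833`, half A line LH7 (closer row `stub_PKtupleK2 : PKtupleLetterK2`, books #181 III-127), banked leaf
ED. 3 road (LH7-plan (g2) `MEMO-ED3.v2` §7 (c); F0P3a-p03 (g20) `CENSUS-O8b-PKmultOneU2.F0P3ap03g20.md`).  THEOREMS ONLY (kernel lane; no `def`, no instance, no notation, no named
fact, no `sorry`).  THE O8b SPLIT: O8b `PKmultOneU2Shape L` ⟺ (O8b♭) ISOTYPY «`Realises₂ P₂ ξ ⇒ U(Φ₂)(𝔸)` acts on `P₂` by `(η ψ)(det g)`» (★ p850173 `pkMultOneU2Shape_of_isotypy` ∕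
`forall_apply_eq_smul_of_pkMultOneU2Shape`), and (O8b♭) = (i) LOCAL at every finite place [★ p850240 on compact subgroups; the `∀ g` upgrade = the «DET-SCALAR» road of F0P3a-p03 (g21),
★ p850416] + (ii) PLACES → `U(Φ₂)(𝔸_{L⁺,f})` on all of `P₂` + (iii) ARCHIMEDEAN.  THIS FILE is (ii) in the CM currency, as the one-screen dress of the generic ★
`DiscreteAutomorphicRepFinAdelicScalar` (this seat) at `χ := (η ψ) ∘ det` (★ `cmDetChar` at `η ψ`, automorphic by ★ `isAutomorphic_eta_mul_psi`):
* §1 **`toContRep_finAdelicToAdelic_apply_eq_smul_of_forall_inclPlaceAdelic₂`** — if at every finite `v` every `u ∈ U(Φ₂)(L⁺_v)` acts on the `U(Φ₂)(𝔸_f)`-smooth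
  vectors of `P₂` by `(η ψ)(det (ι_v u))` (`hloc`: the text of ★ p850240 `toContRep_inclPlaceAdelic_apply_eq_smul_of_realises₂` with its compactness guard `K, hK, hk` removed — the
  head F0P3a-p03 (g21) is paying), then EVERY `b ∈ U(Φ₂)(𝔸_{L⁺,f})` acts on EVERY `f ∈ P₂` by `(η ψ)(det b)`; `…_of_forall_inclPlace₂` — the same from the
  `P₂.finRep.smoothPart ∘ inclPlace v` spelling (★ p850240 `finRep_smoothPart_inclPlace_apply_eq_smul_of_realises₂` minus the guard);
* §2 **`isotypy_of_forall_inclPlaceAdelic_of_forall_archToAdelic`** — with, in addition, the ARCHIMEDEAN input `harch` («`U(Φ₂)(L ⊗ ℝ)` acts on `P₂` by `(η ψ)(det g_∞)`», along ★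
  `archToAdelic`), the full ISOTYPY text `hiso` of ★ p850173 at `(μ₂, ξ, P₂)` holds, so `realises₂_unique_of_isotypy_at` ∕ `pkMultOneU2Shape_of_isotypy` fire: **`pkMultOneU2Shape_of_forall_hloc_harch`**
  — O8b `PKmultOneU2Shape L` from the two per-`(μ₂, ξ, P₂)` inputs `hloc` (finite places, `∀ u`) and `harch` (archimedean).
WHAT REMAINS of O8b in-house after this file and F0P3a-p03 (g21)'s local head: `harch` ONLY — in print: `f ↦ Θ̄ f` is right-`U(Φ₂)(𝔸_f)`-invariant, hence a function on
`U(Φ₂)(L⁺) \ U(Φ₂)(L⁺ ⊗ ℝ)`, and `U(Φ₂)(L⁺)` is DENSE in `U(Φ₂)(L⁺ ⊗ ℝ)` (weak approximation at the archimedean places, [PlatonovRapinchuk1994] §7.3 Prop. 7.8), so it is constant.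
HONEST LABEL: count-neutral ★-lane work (O8b stays the PRINT S organ of the banked ED. 3 until (i)(ii)(iii) all close); HC_CM is proved only modulo the 7 printed citations (2 remaining:
hLiu418 = stmt-HodgeConjecture-24832, h413 = stmt-HodgeConjecture-24833) until rung 0 closes.

## References
* [Rogawski1990] J. D. Rogawski, *Automorphic Representations of Unitary Groups in Three Variables* (1990), §13.3 pp. 202–203 (`m(ξ) = 1`).
* [BorelJacquet1979] A. Borel, H. Jacquet, Corvallis PSPM 33.1 (1979), §4.1, §4.6.
* [PlatonovRapinchuk1994] V. Platonov, A. Rapinchuk, *Algebraic Groups and Number Theory* (1994), §7.3 Prop. 7.8 (weak approximation at `∞`).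
-/

set_option autoImplicit false
-- the mandated namespace repeats the single-problem summit's segment (`HodgeConjecture.HodgeConjecture`)
set_option linter.dupNamespace false

noncomputable section

namespace Summit.HodgeConjecture.HodgeConjecture.Cruxes.H413.F0P3cPKtupleU2FinAdelicIsotypy

open MeasureTheory NumberField IsDedekindDomain
open Literature.NumberTheory Literature.NumberTheory.Automorphic Literature.NumberTheory.Automorphic.UnitaryGroup
open Literature.NumberTheory.Rogawski1990 Literature.NumberTheory.GaloisRepresentations
open Literature.NumberTheory.Automorphic.Arthur2013.Leaves.TECR
open Summit.HodgeConjecture.HodgeConjecture.Cruxes.H413.F0P3GlobalPacketDiscrete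
open Summit.HodgeConjecture.HodgeConjecture.Cruxes.H413.F0P3cPKtupleHSideLetters
open Summit.HodgeConjecture.HodgeConjecture.Cruxes.H413.F0P3cPKtupleU1Line
open Summit.HodgeConjecture.HodgeConjecture.Cruxes.H413.F0P3cPKtupleU2LineUnique

variable {L : Type} [Field L] [NumberField L] [IsCMField L]

/-! ## §1 From the finite places to `U(Φ₂)(𝔸_{L⁺,f})`, on all of `P₂` -/

/-- **PLACES → FINITE ADÈLES, ON ALL OF `P₂`.**  If at every finite place `v` every `u ∈ U(Φ₂)(L⁺_v)` (Π-model ★ `localPi … v`, embedded by ★ `inclPlaceAdelic v`) acts on every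
`U(Φ₂)(𝔸_f)`-smooth vector `f` of the discrete automorphic `P₂` by `(η ψ)(det (ι_v u))` (`hloc` — ★ p850240's conclusion WITHOUT the compactness guard), then EVERY `b ∈ U(Φ₂)(𝔸_{L⁺,f})`
acts on EVERY `f ∈ P₂` by `(η ψ)(det b)`: ★ `DiscreteAutomorphicRep.toContRep_finAdelicToAdelic_apply_eq_smul_of_forall_inclPlaceAdelic` (cofinite-box factorisation of `U(Φ₂)(𝔸_f)`, the
a.e. unramified open kernel of `(η ψ) ∘ det`, and DENSITY of the smooth vectors from `P₂.irreducible`) at the continuous ★ `cmDetChar` of `η ψ`. [cite: Rogawski1990, §13.3 p. 203]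
[cite: BorelJacquet1979, §4.6] -/
theorem toContRep_finAdelicToAdelic_apply_eq_smul_of_forall_inclPlaceAdelic₂
    {μ₂ : Measure (adelicGroupData ↥(maximalRealSubfield L) L (IsCMField.complexConj L) 2 (Matrix.of fun i j : Fin 2 => if i.val + j.val + 1 = 2 then (1 : L) else 0)).automorphicQuotient}
    [(adelicGroupData ↥(maximalRealSubfield L) L (IsCMField.complexConj L) 2 (Matrix.of fun i j : Fin 2 => if i.val + j.val + 1 = 2 then (1 : L) else 0)).IsAutomorphicMeasure μ₂]
    (P₂ : DiscreteAutomorphicRep (adelicGroupData ↥(maximalRealSubfield L) L (IsCMField.complexConj L) 2 (Matrix.of fun i j : Fin 2 => if i.val + j.val + 1 = 2 then (1 : L) else 0)) μ₂) (ξ : OneDimAutRepH L)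
    (hloc : ∀ (v : HeightOneSpectrum (𝓞 ↥(maximalRealSubfield L)))
      (u : ↥(localPi L (IsCMField.complexConj L) 2 (Matrix.of fun i j : Fin 2 => if i.val + j.val + 1 = 2 then (1 : L) else 0) v))
      (f : ↥P₂.space.toSubmodule), f ∈ P₂.finRep.smoothPart →
      P₂.space.toContRep (inclPlaceAdelic ↥(maximalRealSubfield L) L (IsCMField.complexConj L) 2 (Matrix.of fun i j : Fin 2 => if i.val + j.val + 1 = 2 then (1 : L) else 0) v u) f =
        (((cmDetChar L 2 (Matrix.of fun i j : Fin 2 => if i.val + j.val + 1 = 2 then (1 : L) else 0) (ξ.η * ξ.ψ) (isAutomorphic_eta_mul_psi ξ) (isUnit_antidiagOne_det L 2).ne_zero)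
          (inclPlaceAdelic ↥(maximalRealSubfield L) L (IsCMField.complexConj L) 2 (Matrix.of fun i j : Fin 2 => if i.val + j.val + 1 = 2 then (1 : L) else 0) v u) : ℂˣ) : ℂ) • f)
    (b : ↥(finAdelic ↥(maximalRealSubfield L) L (IsCMField.complexConj L) 2 (Matrix.of fun i j : Fin 2 => if i.val + j.val + 1 = 2 then (1 : L) else 0)))
    (f : ↥P₂.space.toSubmodule) :
    P₂.space.toContRep (finAdelicToAdelic ↥(maximalRealSubfield L) L (IsCMField.complexConj L) 2 (Matrix.of fun i j : Fin 2 => if i.val + j.val + 1 = 2 then (1 : L) else 0) b) f =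
      (((cmDetChar L 2 (Matrix.of fun i j : Fin 2 => if i.val + j.val + 1 = 2 then (1 : L) else 0) (ξ.η * ξ.ψ) (isAutomorphic_eta_mul_psi ξ) (isUnit_antidiagOne_det L 2).ne_zero)
        (finAdelicToAdelic ↥(maximalRealSubfield L) L (IsCMField.complexConj L) 2 (Matrix.of fun i j : Fin 2 => if i.val + j.val + 1 = 2 then (1 : L) else 0) b) : ℂˣ) : ℂ) • f :=
  P₂.toContRep_finAdelicToAdelic_apply_eq_smul_of_forall_inclPlaceAdelic
    (cmDetChar L 2 (Matrix.of fun i j : Fin 2 => if i.val + j.val + 1 = 2 then (1 : L) else 0) (ξ.η * ξ.ψ) (isAutomorphic_eta_mul_psi ξ) (isUnit_antidiagOne_det L 2).ne_zero).toMonoidHom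
    (cmDetChar L 2 (Matrix.of fun i j : Fin 2 => if i.val + j.val + 1 = 2 then (1 : L) else 0) (ξ.η * ξ.ψ) (isAutomorphic_eta_mul_psi ξ) (isUnit_antidiagOne_det L 2).ne_zero).continuous
    hloc b f

/-- **The same from the `P₂.finRep.smoothPart ∘ inclPlace v` spelling** (★ p850240 `finRep_smoothPart_inclPlace_apply_eq_smul_of_realises₂` WITHOUT the compactness guard): every
`b ∈ U(Φ₂)(𝔸_{L⁺,f})` acts on every `f ∈ P₂` by `(η ψ)(det b)`. [cite: Rogawski1990, §13.3 p. 203] [cite: BorelJacquet1979, §4.6] -/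
theorem toContRep_finAdelicToAdelic_apply_eq_smul_of_forall_inclPlace₂
    {μ₂ : Measure (adelicGroupData ↥(maximalRealSubfield L) L (IsCMField.complexConj L) 2 (Matrix.of fun i j : Fin 2 => if i.val + j.val + 1 = 2 then (1 : L) else 0)).automorphicQuotient}
    [(adelicGroupData ↥(maximalRealSubfield L) L (IsCMField.complexConj L) 2 (Matrix.of fun i j : Fin 2 => if i.val + j.val + 1 = 2 then (1 : L) else 0)).IsAutomorphicMeasure μ₂]
    (P₂ : DiscreteAutomorphicRep (adelicGroupData ↥(maximalRealSubfield L) L (IsCMField.complexConj L) 2 (Matrix.of fun i j : Fin 2 => if i.val + j.val + 1 = 2 then (1 : L) else 0)) μ₂) (ξ : OneDimAutRepH L)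
    (hloc' : ∀ (v : HeightOneSpectrum (𝓞 ↥(maximalRealSubfield L)))
      (u : ↥(localPi L (IsCMField.complexConj L) 2 (Matrix.of fun i j : Fin 2 => if i.val + j.val + 1 = 2 then (1 : L) else 0) v))
      (f : ↥P₂.finRep.smoothPart.toSubmodule),
      P₂.finRep.smoothPart.toRepresentation (inclPlace ↥(maximalRealSubfield L) L (IsCMField.complexConj L) 2 (Matrix.of fun i j : Fin 2 => if i.val + j.val + 1 = 2 then (1 : L) else 0) v u) f =
        (((cmDetChar L 2 (Matrix.of fun i j : Fin 2 => if i.val + j.val + 1 = 2 then (1 : L) else 0) (ξ.η * ξ.ψ) (isAutomorphic_eta_mul_psi ξ) (isUnit_antidiagOne_det L 2).ne_zero)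
          (inclPlaceAdelic ↥(maximalRealSubfield L) L (IsCMField.complexConj L) 2 (Matrix.of fun i j : Fin 2 => if i.val + j.val + 1 = 2 then (1 : L) else 0) v u) : ℂˣ) : ℂ) • f)
    (b : ↥(finAdelic ↥(maximalRealSubfield L) L (IsCMField.complexConj L) 2 (Matrix.of fun i j : Fin 2 => if i.val + j.val + 1 = 2 then (1 : L) else 0)))
    (f : ↥P₂.space.toSubmodule) :
    P₂.space.toContRep (finAdelicToAdelic ↥(maximalRealSubfield L) L (IsCMField.complexConj L) 2 (Matrix.of fun i j : Fin 2 => if i.val + j.val + 1 = 2 then (1 : L) else 0) b) f =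
      (((cmDetChar L 2 (Matrix.of fun i j : Fin 2 => if i.val + j.val + 1 = 2 then (1 : L) else 0) (ξ.η * ξ.ψ) (isAutomorphic_eta_mul_psi ξ) (isUnit_antidiagOne_det L 2).ne_zero)
        (finAdelicToAdelic ↥(maximalRealSubfield L) L (IsCMField.complexConj L) 2 (Matrix.of fun i j : Fin 2 => if i.val + j.val + 1 = 2 then (1 : L) else 0) b) : ℂˣ) : ℂ) • f :=
  P₂.toContRep_finAdelicToAdelic_apply_eq_smul_of_forall_inclPlace
    (cmDetChar L 2 (Matrix.of fun i j : Fin 2 => if i.val + j.val + 1 = 2 then (1 : L) else 0) (ξ.η * ξ.ψ) (isAutomorphic_eta_mul_psi ξ) (isUnit_antidiagOne_det L 2).ne_zero).toMonoidHom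
    (cmDetChar L 2 (Matrix.of fun i j : Fin 2 => if i.val + j.val + 1 = 2 then (1 : L) else 0) (ξ.η * ξ.ψ) (isAutomorphic_eta_mul_psi ξ) (isUnit_antidiagOne_det L 2).ne_zero).continuous
    hloc' b f

/-! ## §2 Reduction of the ISOTYPY letter (O8b♭), hence of O8b, to the finite-place input `hloc` and the archimedean input `harch` -/

/-- **ISOTYPY AT `(μ₂, ξ, P₂)` FROM `hloc` + `harch`.**  If at every finite place every `u ∈ U(Φ₂)(L⁺_v)` acts on the `U(Φ₂)(𝔸_f)`-smooth vectors of `P₂` by `(η ψ)(det (ι_v u))` (`hloc`) and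
the archimedean group `U(Φ₂)(L ⊗ ℝ)` (★ `arch`, along ★ `archToAdelic`) acts on `P₂` by `(η ψ)(det g_∞)` (`harch`), then ALL of `U(Φ₂)(𝔸_{L⁺})` acts on `P₂` by `(η ψ)(det g)` — the text of the
hypothesis `hP` ∕ `hiso` of ★ p850173 `eq_ofChar_of_forall_apply_eq_smul₂` ∕ `realises₂_unique_of_isotypy_at` (★ `…_of_forall_archToAdelic`: `g = g_∞ · g_f`). [cite: Rogawski1990, §13.3 p. 203]
[cite: BorelJacquet1979, §4.1, §4.6] -/
theorem isotypy_of_forall_inclPlaceAdelic_of_forall_archToAdelic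
    {μ₂ : Measure (adelicGroupData ↥(maximalRealSubfield L) L (IsCMField.complexConj L) 2 (Matrix.of fun i j : Fin 2 => if i.val + j.val + 1 = 2 then (1 : L) else 0)).automorphicQuotient}
    [(adelicGroupData ↥(maximalRealSubfield L) L (IsCMField.complexConj L) 2 (Matrix.of fun i j : Fin 2 => if i.val + j.val + 1 = 2 then (1 : L) else 0)).IsAutomorphicMeasure μ₂]
    (P₂ : DiscreteAutomorphicRep (adelicGroupData ↥(maximalRealSubfield L) L (IsCMField.complexConj L) 2 (Matrix.of fun i j : Fin 2 => if i.val + j.val + 1 = 2 then (1 : L) else 0)) μ₂) (ξ : OneDimAutRepH L)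
    (hloc : ∀ (v : HeightOneSpectrum (𝓞 ↥(maximalRealSubfield L)))
      (u : ↥(localPi L (IsCMField.complexConj L) 2 (Matrix.of fun i j : Fin 2 => if i.val + j.val + 1 = 2 then (1 : L) else 0) v))
      (f : ↥P₂.space.toSubmodule), f ∈ P₂.finRep.smoothPart →
      P₂.space.toContRep (inclPlaceAdelic ↥(maximalRealSubfield L) L (IsCMField.complexConj L) 2 (Matrix.of fun i j : Fin 2 => if i.val + j.val + 1 = 2 then (1 : L) else 0) v u) f =
        (((cmDetChar L 2 (Matrix.of fun i j : Fin 2 => if i.val + j.val + 1 = 2 then (1 : L) else 0) (ξ.η * ξ.ψ) (isAutomorphic_eta_mul_psi ξ) (isUnit_antidiagOne_det L 2).ne_zero)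
          (inclPlaceAdelic ↥(maximalRealSubfield L) L (IsCMField.complexConj L) 2 (Matrix.of fun i j : Fin 2 => if i.val + j.val + 1 = 2 then (1 : L) else 0) v u) : ℂˣ) : ℂ) • f)
    (harch : ∀ (a : ↥(arch ↥(maximalRealSubfield L) L (IsCMField.complexConj L) 2 (Matrix.of fun i j : Fin 2 => if i.val + j.val + 1 = 2 then (1 : L) else 0)))
      (f : ↥P₂.space.toSubmodule),
      P₂.space.toContRep (archToAdelic ↥(maximalRealSubfield L) L (IsCMField.complexConj L) 2 (Matrix.of fun i j : Fin 2 => if i.val + j.val + 1 = 2 then (1 : L) else 0) a) f =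
        (((cmDetChar L 2 (Matrix.of fun i j : Fin 2 => if i.val + j.val + 1 = 2 then (1 : L) else 0) (ξ.η * ξ.ψ) (isAutomorphic_eta_mul_psi ξ) (isUnit_antidiagOne_det L 2).ne_zero)
          (archToAdelic ↥(maximalRealSubfield L) L (IsCMField.complexConj L) 2 (Matrix.of fun i j : Fin 2 => if i.val + j.val + 1 = 2 then (1 : L) else 0) a) : ℂˣ) : ℂ) • f)
    (g : (adelicGroupData ↥(maximalRealSubfield L) L (IsCMField.complexConj L) 2 (Matrix.of fun i j : Fin 2 => if i.val + j.val + 1 = 2 then (1 : L) else 0)).Adelic)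
    (f : ↥P₂.space.toSubmodule) :
    P₂.space.toContRep g f =
      (((cmDetChar L 2 (Matrix.of fun i j : Fin 2 => if i.val + j.val + 1 = 2 then (1 : L) else 0) (ξ.η * ξ.ψ) (isAutomorphic_eta_mul_psi ξ) (isUnit_antidiagOne_det L 2).ne_zero) g : ℂˣ) : ℂ) • f :=
  P₂.toContRep_apply_eq_smul_of_forall_inclPlaceAdelic_of_forall_archToAdelic
    (cmDetChar L 2 (Matrix.of fun i j : Fin 2 => if i.val + j.val + 1 = 2 then (1 : L) else 0) (ξ.η * ξ.ψ) (isAutomorphic_eta_mul_psi ξ) (isUnit_antidiagOne_det L 2).ne_zero).toMonoidHom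
    (cmDetChar L 2 (Matrix.of fun i j : Fin 2 => if i.val + j.val + 1 = 2 then (1 : L) else 0) (ξ.η * ξ.ψ) (isAutomorphic_eta_mul_psi ξ) (isUnit_antidiagOne_det L 2).ne_zero).continuous
    hloc harch g f

/-- **UNIQUENESS OF THE REALISING `P₂` AT `(μ₂, ξ)` FROM `hloc` + `harch`** (the premise `hm1` of ★ `F0P3cPKtupleNHOneOfKD5H.nH_eq_one_of_kd5Hflat`): if for every discrete automorphic `P₂` in
`L²(μ₂)` realising `ξ_v ∘ inl` at every finite place the finite-place input `hloc` and the archimedean input `harch` hold, then two realising `P₂, P₂′` coincide (★ p850173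
`realises₂_unique_of_isotypy_at` ∘ §2). [cite: Rogawski1990, §13.3 p. 203] -/
theorem realises₂_unique_of_forall_hloc_harch_at
    {μ₂ : Measure (adelicGroupData ↥(maximalRealSubfield L) L (IsCMField.complexConj L) 2 (Matrix.of fun i j : Fin 2 => if i.val + j.val + 1 = 2 then (1 : L) else 0)).automorphicQuotient}
    [(adelicGroupData ↥(maximalRealSubfield L) L (IsCMField.complexConj L) 2 (Matrix.of fun i j : Fin 2 => if i.val + j.val + 1 = 2 then (1 : L) else 0)).IsAutomorphicMeasure μ₂] (ξ : OneDimAutRepH L)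
    (hloc : ∀ P₂ : DiscreteAutomorphicRep (adelicGroupData ↥(maximalRealSubfield L) L (IsCMField.complexConj L) 2 (Matrix.of fun i j : Fin 2 => if i.val + j.val + 1 = 2 then (1 : L) else 0)) μ₂,
      Realises₂ P₂ ξ → ∀ (v : HeightOneSpectrum (𝓞 ↥(maximalRealSubfield L)))
      (u : ↥(localPi L (IsCMField.complexConj L) 2 (Matrix.of fun i j : Fin 2 => if i.val + j.val + 1 = 2 then (1 : L) else 0) v))
      (f : ↥P₂.space.toSubmodule), f ∈ P₂.finRep.smoothPart →
      P₂.space.toContRep (inclPlaceAdelic ↥(maximalRealSubfield L) L (IsCMField.complexConj L) 2 (Matrix.of fun i j : Fin 2 => if i.val + j.val + 1 = 2 then (1 : L) else 0) v u) f =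
        (((cmDetChar L 2 (Matrix.of fun i j : Fin 2 => if i.val + j.val + 1 = 2 then (1 : L) else 0) (ξ.η * ξ.ψ) (isAutomorphic_eta_mul_psi ξ) (isUnit_antidiagOne_det L 2).ne_zero)
          (inclPlaceAdelic ↥(maximalRealSubfield L) L (IsCMField.complexConj L) 2 (Matrix.of fun i j : Fin 2 => if i.val + j.val + 1 = 2 then (1 : L) else 0) v u) : ℂˣ) : ℂ) • f)
    (harch : ∀ P₂ : DiscreteAutomorphicRep (adelicGroupData ↥(maximalRealSubfield L) L (IsCMField.complexConj L) 2 (Matrix.of fun i j : Fin 2 => if i.val + j.val + 1 = 2 then (1 : L) else 0)) μ₂,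
      Realises₂ P₂ ξ → ∀ (a : ↥(arch ↥(maximalRealSubfield L) L (IsCMField.complexConj L) 2 (Matrix.of fun i j : Fin 2 => if i.val + j.val + 1 = 2 then (1 : L) else 0)))
      (f : ↥P₂.space.toSubmodule),
      P₂.space.toContRep (archToAdelic ↥(maximalRealSubfield L) L (IsCMField.complexConj L) 2 (Matrix.of fun i j : Fin 2 => if i.val + j.val + 1 = 2 then (1 : L) else 0) a) f =
        (((cmDetChar L 2 (Matrix.of fun i j : Fin 2 => if i.val + j.val + 1 = 2 then (1 : L) else 0) (ξ.η * ξ.ψ) (isAutomorphic_eta_mul_psi ξ) (isUnit_antidiagOne_det L 2).ne_zero)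
          (archToAdelic ↥(maximalRealSubfield L) L (IsCMField.complexConj L) 2 (Matrix.of fun i j : Fin 2 => if i.val + j.val + 1 = 2 then (1 : L) else 0) a) : ℂˣ) : ℂ) • f)
    (P₂ P₂' : DiscreteAutomorphicRep (adelicGroupData ↥(maximalRealSubfield L) L (IsCMField.complexConj L) 2 (Matrix.of fun i j : Fin 2 => if i.val + j.val + 1 = 2 then (1 : L) else 0)) μ₂)
    (h : Realises₂ P₂ ξ) (h' : Realises₂ P₂' ξ) : P₂ = P₂' :=
  realises₂_unique_of_isotypy_at ξ
    (fun P₂ hP₂ g f => isotypy_of_forall_inclPlaceAdelic_of_forall_archToAdelic P₂ ξ (hloc P₂ hP₂) (harch P₂ hP₂) g f) P₂ P₂' h h'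

/-- **O8b `PKmultOneU2Shape L` FROM THE TWO INPUTS `hloc` (every finite place, `∀ u`) AND `harch` (archimedean)** — ★ p850173 `pkMultOneU2Shape_of_isotypy` ∘ §2: the letter O8b of
the banked LH7 leaf ED. 3 is reduced to «`Realises₂ P₂ ξ ⇒ hloc`» (the LOCAL head, DET-SCALAR road) and «`Realises₂ P₂ ξ ⇒ harch`» (weak approximation at `∞`), uniformly in `(μ₂, ξ, P₂)`.
[cite: Rogawski1990, §13.3 p. 203] [cite: PlatonovRapinchuk1994, §7.3 Prop. 7.8] -/
theorem pkMultOneU2Shape_of_forall_hloc_harch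
    (hloc : ∀ (μ₂ : Measure (adelicGroupData ↥(maximalRealSubfield L) L (IsCMField.complexConj L) 2 (Matrix.of fun i j : Fin 2 => if i.val + j.val + 1 = 2 then (1 : L) else 0)).automorphicQuotient)
      [(adelicGroupData ↥(maximalRealSubfield L) L (IsCMField.complexConj L) 2 (Matrix.of fun i j : Fin 2 => if i.val + j.val + 1 = 2 then (1 : L) else 0)).IsAutomorphicMeasure μ₂] (ξ : OneDimAutRepH L)
      (P₂ : DiscreteAutomorphicRep (adelicGroupData ↥(maximalRealSubfield L) L (IsCMField.complexConj L) 2 (Matrix.of fun i j : Fin 2 => if i.val + j.val + 1 = 2 then (1 : L) else 0)) μ₂),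
      Realises₂ P₂ ξ → ∀ (v : HeightOneSpectrum (𝓞 ↥(maximalRealSubfield L)))
      (u : ↥(localPi L (IsCMField.complexConj L) 2 (Matrix.of fun i j : Fin 2 => if i.val + j.val + 1 = 2 then (1 : L) else 0) v))
      (f : ↥P₂.space.toSubmodule), f ∈ P₂.finRep.smoothPart →
      P₂.space.toContRep (inclPlaceAdelic ↥(maximalRealSubfield L) L (IsCMField.complexConj L) 2 (Matrix.of fun i j : Fin 2 => if i.val + j.val + 1 = 2 then (1 : L) else 0) v u) f =
        (((cmDetChar L 2 (Matrix.of fun i j : Fin 2 => if i.val + j.val + 1 = 2 then (1 : L) else 0) (ξ.η * ξ.ψ) (isAutomorphic_eta_mul_psi ξ) (isUnit_antidiagOne_det L 2).ne_zero)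
          (inclPlaceAdelic ↥(maximalRealSubfield L) L (IsCMField.complexConj L) 2 (Matrix.of fun i j : Fin 2 => if i.val + j.val + 1 = 2 then (1 : L) else 0) v u) : ℂˣ) : ℂ) • f)
    (harch : ∀ (μ₂ : Measure (adelicGroupData ↥(maximalRealSubfield L) L (IsCMField.complexConj L) 2 (Matrix.of fun i j : Fin 2 => if i.val + j.val + 1 = 2 then (1 : L) else 0)).automorphicQuotient)
      [(adelicGroupData ↥(maximalRealSubfield L) L (IsCMField.complexConj L) 2 (Matrix.of fun i j : Fin 2 => if i.val + j.val + 1 = 2 then (1 : L) else 0)).IsAutomorphicMeasure μ₂] (ξ : OneDimAutRepH L)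
      (P₂ : DiscreteAutomorphicRep (adelicGroupData ↥(maximalRealSubfield L) L (IsCMField.complexConj L) 2 (Matrix.of fun i j : Fin 2 => if i.val + j.val + 1 = 2 then (1 : L) else 0)) μ₂),
      Realises₂ P₂ ξ → ∀ (a : ↥(arch ↥(maximalRealSubfield L) L (IsCMField.complexConj L) 2 (Matrix.of fun i j : Fin 2 => if i.val + j.val + 1 = 2 then (1 : L) else 0)))
      (f : ↥P₂.space.toSubmodule),
      P₂.space.toContRep (archToAdelic ↥(maximalRealSubfield L) L (IsCMField.complexConj L) 2 (Matrix.of fun i j : Fin 2 => if i.val + j.val + 1 = 2 then (1 : L) else 0) a) f =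
        (((cmDetChar L 2 (Matrix.of fun i j : Fin 2 => if i.val + j.val + 1 = 2 then (1 : L) else 0) (ξ.η * ξ.ψ) (isAutomorphic_eta_mul_psi ξ) (isUnit_antidiagOne_det L 2).ne_zero)
          (archToAdelic ↥(maximalRealSubfield L) L (IsCMField.complexConj L) 2 (Matrix.of fun i j : Fin 2 => if i.val + j.val + 1 = 2 then (1 : L) else 0) a) : ℂˣ) : ℂ) • f) :
    PKmultOneU2Shape L :=
  pkMultOneU2Shape_of_isotypy fun μ₂ _ ξ P₂ hP₂ g f =>
    isotypy_of_forall_inclPlaceAdelic_of_forall_archToAdelic P₂ ξ (hloc μ₂ ξ P₂ hP₂) (harch μ₂ ξ P₂ hP₂) g f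

end Summit.HodgeConjecture.HodgeConjecture.Cruxes.H413.F0P3cPKtupleU2FinAdelicIsotypy

end
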